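import Summits.SmoothPoincare4.SmoothPoincare4.Theorems.ConvexBisectionAcyclicBisectionExistsPageTubeMap
import Literature.Topology.FourManifolds.WhitneyModelSheets
import Literature.Topology.FourManifolds.FramedCircleTube
import HarnessLib

/-!
# Tubes from local diffeomorphisms along a compact zero section; the page-adapted tube map
(wave 3, worker Z4, brick T3c-1 (3b) "page-adapted circle tube", part 4, of stub
`stub_steinRealisation` = NF6 `Literature.Geometry.Symplectic.steinRealisation_of_sorted_modelsOnFibred`,
line `modp-braid-orbits` r11, crux `ConvexBisection.AcyclicBisectionExists`, item
stmt-SmoothPoincare4-10508; registered sub-goal `helper_tube_of_localDiffeo_zero`)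

* §1 `helper_tube_of_localDiffeo_zero` — **a smooth map `G : M × F → X` (`M` compact) which is a local
  diffeomorphism at, and injective along, the zero section restricts to a diffeomorphism of a tube
  `M × B(0, ε)` onto an open subset of `X`**, an open partial homeomorphism `C^∞` with `C^∞` inverse
  (Kosinski 1993, III Thm. 2.2 / Hirsch 1976, Ch. 4 §5 Thm. 5.1: local diffeomorphisms on a uniform
  tube by compactness, injectivity on a smaller tube, `exists_injOn_prod_ball_of_continuousAt`; the
  argument of the tree's `exists_framedTube`, freed from its particular tube map), the tube moreover
  inside any prescribed open neighbourhood `W` of the zero section;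
* §2 the corestricted tube map `tubeMap` of a page curve (`…PageTubeMap.lean`) is a local
  diffeomorphism of `𝕊¹ × ℝ²` into the 3-manifold `∂ Base g` wherever its ambient differential is
  injective (`isLocalDiffeomorphAt_tubeMap`: inverse function theorem
  `isLocalDiffeomorphAt_of_mfderiv_injective`; the ambient differential factors through that of the
  corestriction along the smooth inclusion `∂ Base g ↪ ℝ⁴`).

Everything is proved; no named facts, no `sorry`.  References: A. A. Kosinski, *Differential
Manifolds* (1993), III Thm. 2.2, (3.1) [Kosinski1993]; M. W. Hirsch, *Differential Topology* (1976),
Ch. 4 §5 Thm. 5.1 [HirschDT1976]; J. M. Lee, *Introduction to Smooth Manifolds* (2012), Thm. 4.5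
[LeeSmoothManifolds2013].
-/

noncomputable section

set_option linter.dupNamespace false

open scoped Manifold ContDiff Topology ComplexConjugate
open Set Function Metric Filter
open Literature.Topology.FourManifolds Literature.Topology.FourManifolds.LefschetzBase
open Literature.Geometry.Symplectic

namespace Summit.SmoothPoincare4.SmoothPoincare4.Theorems.AcyclicBisectionExists.ModpBraidOrbits

variable {g : ℕ}

/-! ## §1 A local diffeomorphism along a compact injective zero section is a tube diffeomorphism -/

/-- **A smooth map which is a local diffeomorphism at, and injective along, a compact zero section
is a diffeomorphism of a tube onto an open set** (registered sub-goal
`helper_tube_of_localDiffeo_zero` of NF6, brick T3c-1 (3b)).  Let `M` be a compact manifold, `F` a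
normed space, `X` a Hausdorff manifold and `G : M × F → X` a map which is a `C^∞` local
diffeomorphism at every point `(x, 0)` and injective on the zero section, and `W` an open
neighbourhood of the zero section.  Then for some `ε > 0` there is an open partial homeomorphism
`Φ : M × F ⇀ X`, equal to `G` as a map, with source the tube `M × B(0, ε) ⊆ W`, `C^∞` on its source
with `C^∞` inverse on its (open) target: local diffeomorphisms form an open set, which contains a
uniform tube by compactness; `G` is injective on a smaller tube
(`exists_injOn_prod_ball_of_continuousAt`); an injective open continuous map is a homeomorphism onto
its open image, and its inverse is locally one of the local inverses.  Kosinski (1993), III Thm. 2.2;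
Hirsch (1976), Ch. 4 §5, Thm. 5.1. [cite: Kosinski1993, III Thm. 2.2] -/
theorem helper_tube_of_localDiffeo_zero : ∀ {EM : Type*} [NormedAddCommGroup EM] [NormedSpace ℝ EM]
    {HM : Type*} [TopologicalSpace HM] {IM : ModelWithCorners ℝ EM HM}
    {M : Type*} [TopologicalSpace M] [ChartedSpace HM M] [CompactSpace M] [Nonempty M]
    {E' : Type*} [NormedAddCommGroup E'] [NormedSpace ℝ E'] {H' : Type*} [TopologicalSpace H']
    {J : ModelWithCorners ℝ E' H'} {X : Type*} [TopologicalSpace X] [ChartedSpace H' X] [T2Space X]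
    {F : Type*} [NormedAddCommGroup F] [NormedSpace ℝ F] {G : M × F → X} {W : Set (M × F)},
    (∀ x, IsLocalDiffeomorphAt (IM.prod 𝓘(ℝ, F)) J ∞ G (x, 0)) →
    (Function.Injective fun x => G (x, 0)) → IsOpen W → (∀ x, (x, (0 : F)) ∈ W) →
    ∃ (Φ : OpenPartialHomeomorph (M × F) X) (ε : ℝ), 0 < ε ∧
      Φ.source = (Set.univ : Set M) ×ˢ Metric.ball (0 : F) ε ∧ Φ.source ⊆ W ∧ ⇑Φ = G ∧
      ContMDiffOn (IM.prod 𝓘(ℝ, F)) J ∞ Φ Φ.source ∧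
      ContMDiffOn J (IM.prod 𝓘(ℝ, F)) ∞ Φ.symm Φ.target := by
  intro EM _ _ HM _ IM M _ _ _ _ E' _ _ H' _ J X _ _ _ F _ _ G W hloc0 hinj hW hW0
  -- a uniform tube of local diffeomorphisms inside `W`
  obtain ⟨ε₁, hε₁, hloc⟩ : ∃ ε₁ > 0, ∀ q : M × F, q.2 ∈ ball (0 : F) ε₁ →
      IsLocalDiffeomorphAt (IM.prod 𝓘(ℝ, F)) J ∞ G q ∧ q ∈ W := by
    have hopen := (isOpen_setOf_isLocalDiffeomorphAt (I := IM.prod 𝓘(ℝ, F)) (J := J)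
      (n := ∞) G).inter hW
    have hsub : (univ : Set M) ×ˢ ({0} : Set F) ⊆
        {q | IsLocalDiffeomorphAt (IM.prod 𝓘(ℝ, F)) J ∞ G q} ∩ W := by
      rintro ⟨x, v⟩ ⟨-, hv⟩
      rw [mem_singleton_iff] at hv
      subst hv
      exact ⟨hloc0 x, hW0 x⟩
    obtain ⟨U, V, -, hV, hU, h0V, hUV⟩ :=
      generalized_tube_lemma isCompact_univ isCompact_singleton hopen hsub
    obtain ⟨ε, hε, hball⟩ := Metric.isOpen_iff.1 hV 0 (h0V rfl)
    exact ⟨ε, hε, fun q hq => hUV ⟨hU (mem_univ _), hball hq⟩⟩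
  -- injectivity on a uniform tube
  obtain ⟨ε₂, hε₂, hinjOn⟩ : ∃ ε₂ > 0, InjOn G ((univ : Set M) ×ˢ ball (0 : F) ε₂) := by
    refine exists_injOn_prod_ball_of_continuousAt (fun x => (hloc0 x).contMDiffAt.continuousAt)
      hinj fun x => ?_
    obtain ⟨Ψ, hx, heq⟩ := hloc0 x
    exact ⟨Ψ.source, Ψ.open_source.mem_nhds hx, fun a ha b hb hab =>
      Ψ.injOn ha hb (by rwa [← heq ha, ← heq hb])⟩
  -- the tube of radius `ε = min ε₁ ε₂`
  set ε : ℝ := min ε₁ ε₂ with hε_def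
  have hε : 0 < ε := lt_min hε₁ hε₂
  set O : Set (M × F) := (univ : Set M) ×ˢ ball (0 : F) ε with hO_def
  have hOo : IsOpen O := isOpen_univ.prod isOpen_ball
  have hO₁ : ∀ q ∈ O, IsLocalDiffeomorphAt (IM.prod 𝓘(ℝ, F)) J ∞ G q := fun q hq =>
    (hloc q (ball_subset_ball (min_le_left _ _) hq.2)).1
  have hOW : O ⊆ W := fun q hq => (hloc q (ball_subset_ball (min_le_left _ _) hq.2)).2
  have hinjO : InjOn G O := hinjOn.mono (prod_mono Subset.rfl (ball_subset_ball (min_le_right _ _)))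
  have hGO : ContMDiffOn (IM.prod 𝓘(ℝ, F)) J ∞ G O := fun q hq =>
    (hO₁ q hq).contMDiffAt.contMDiffWithinAt
  -- the partial equivalence and the open partial homeomorphism
  set e : PartialEquiv (M × F) X := hinjO.toPartialEquiv G O with he_def
  have he_coe : (e : M × F → X) = G := rfl
  have he_source : e.source = O := rfl
  have hopen : IsOpenMap (e.source.restrict e) := by
    rw [he_source, he_coe]
    exact isOpenMap_restrict_of_nhds_le hOo fun q hq => nhds_le_map_of_isLocalDiffeomorphAt (hO₁ q hq)
  set Φ : OpenPartialHomeomorph (M × F) X :=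
    OpenPartialHomeomorph.ofContinuousOpenRestrict e (by rw [he_source, he_coe]; exact hGO.continuousOn)
      hopen (by rw [he_source]; exact hOo) with hΦ_def
  have hΦ_coe : (Φ : M × F → X) = G := rfl
  have hΦ_source : Φ.source = O := rfl
  refine ⟨Φ, ε, hε, hΦ_source, hOW, hΦ_coe, by rw [hΦ_coe, hΦ_source]; exact hGO, ?_⟩
  -- the inverse is smooth: near each point it is a local inverse of `G`
  rintro y hy
  obtain ⟨q, hq, rfl⟩ : y ∈ G '' O := by
    rw [← he_coe, ← he_source, e.image_source_eq_target]; exact hy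
  have hld := hO₁ q hq
  apply ContMDiffAt.contMDiffWithinAt
  have hT : O ∩ hld.localInverse.target ∈ 𝓝 q :=
    inter_mem (hOo.mem_nhds hq) (hld.localInverse.open_target.mem_nhds hld.localInverse_mem_target)
  have himg : G '' (O ∩ hld.localInverse.target) ∈ 𝓝 (G q) :=
    nhds_le_map_of_isLocalDiffeomorphAt hld (image_mem_map hT)
  have hev : (Φ.symm : X → M × F) =ᶠ[𝓝 (G q)] hld.localInverse := by
    filter_upwards [himg] with _ hy'
    obtain ⟨q', ⟨hq'O, hq'T⟩, rfl⟩ := hy'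
    rw [hld.localInverse_left_inv hq'T]
    exact Φ.left_inv (show q' ∈ Φ.source from hq'O)
  exact hld.localInverse_contMDiffAt.congr_of_eventuallyEq hev

/-! ## §2 The corestricted tube map of a page curve is a local diffeomorphism -/

section LocalDiffeo

variable {θ : ℝ × EuclideanSpace ℝ (Fin 4) → EuclideanSpace ℝ (Fin 4)}
  {Θ : ℝ × (EuclideanSpace ℝ (Fin 4) × ℂ) → EuclideanSpace ℝ (Fin 4) × ℂ}
  {K : sphere (0 : EuclideanSpace ℝ (Fin 2)) 1 → Base g}

/-- **The corestricted tube map is a local diffeomorphism at a point of the zero section where the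
ambient differential is injective** (inverse function theorem between `𝕊¹ × ℝ²` and the 3-manifold
`∂ Base g`; the ambient differential factors through that of the corestriction).
[cite: LeeSmoothManifolds2013, Thm. 4.5] -/
theorem isLocalDiffeomorphAt_tubeMap {m : sphere (0 : EuclideanSpace ℝ (Fin 2)) 1 → ℂ}
    (hmem : ∀ q, rho g (tubeAmb θ Θ K m q) = 1 / 4)
    (hsm : ContMDiff ((𝓡 1).prod 𝓘(ℝ, EuclideanSpace ℝ (Fin 2))) 𝓘(ℝ, EuclideanSpace ℝ (Fin 4)) ∞
      (tubeAmb θ Θ K m))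
    {q : sphere (0 : EuclideanSpace ℝ (Fin 2)) 1 × EuclideanSpace ℝ (Fin 2)}
    (hinj : Injective (mfderiv ((𝓡 1).prod 𝓘(ℝ, EuclideanSpace ℝ (Fin 2)))
      𝓘(ℝ, EuclideanSpace ℝ (Fin 4)) (tubeAmb θ Θ K m) q)) :
    IsLocalDiffeomorphAt ((𝓡 1).prod 𝓘(ℝ, EuclideanSpace ℝ (Fin 2))) (𝓡 3) ∞ (tubeMap hmem) q := by
  refine isLocalDiffeomorphAt_of_mfderiv_injective isOpen_univ (mem_univ _)
    (contMDiff_tubeMap hmem hsm).contMDiffOn (by simp) (by simp [Module.finrank_prod]) ?_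
  have hval : ContMDiff (𝓡 3) 𝓘(ℝ, EuclideanSpace ℝ (Fin 4)) ∞
      fun y : (bBase g).carrier => RegularSublevel.incl (isRegularLevel_rho g) ((bBase g).incl y) :=
    (RegularSublevel.contMDiff_incl (isRegularLevel_rho g)).comp (bBase g).isSmoothEmbedding.contMDiff
  have hfun : tubeAmb θ Θ K m =
      (fun y : (bBase g).carrier => RegularSublevel.incl (isRegularLevel_rho g) ((bBase g).incl y)) ∘
        tubeMap hmem := rfl
  have key : ∀ x, mfderiv ((𝓡 1).prod 𝓘(ℝ, EuclideanSpace ℝ (Fin 2))) 𝓘(ℝ, EuclideanSpace ℝ (Fin 4))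
      (tubeAmb θ Θ K m) q x = mfderiv (𝓡 3) 𝓘(ℝ, EuclideanSpace ℝ (Fin 4))
        (fun y : (bBase g).carrier => RegularSublevel.incl (isRegularLevel_rho g) ((bBase g).incl y))
        (tubeMap hmem q) (mfderiv ((𝓡 1).prod 𝓘(ℝ, EuclideanSpace ℝ (Fin 2))) (𝓡 3) (tubeMap hmem) q x) :=
    fun x => by
      rw [hfun, mfderiv_comp q (hval.mdifferentiableAt (by simp))
        ((contMDiff_tubeMap hmem hsm).mdifferentiableAt (by simp))]
      rfl
  intro a b hab
  exact hinj (by rw [key, key, hab])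

end LocalDiffeo

end Summit.SmoothPoincare4.SmoothPoincare4.Theorems.AcyclicBisectionExists.ModpBraidOrbits
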